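import Literature.NumberTheory.Sieve.QuadraticRootsPrimeModuliDFIPoincareNorm
import Literature.NumberTheory.Sieve.QuadraticRootsPrimeModuliDFIPoincareKloosterman
import Literature.NumberTheory.Sieve.QuadraticRootsPrimeModuliDFIDivisorSums
import HarnessLib

/-!
# The `L²`-norm of the Poincaré series of a strip kernel on `Γ₀(q)∖ℍ`: the bound (DFI 1995, Prop. 4, support file)

Topic `Literature/NumberTheory/Sieve`.  Sixth support file of the elementary proof of Proposition 4
of W. Duke, J. B. Friedlander, H. Iwaniec, *Equidistribution of roots of a quadratic congruence to
prime moduli*, Ann. of Math. 141 (1995).  Assembly of `…DFIPoincareNorm` (unfolding),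
`…DFIPoincareKloosterman` (Kloosterman sums, Weil's bound, the integrals `I_c`) and
`…DFIDivisorSums` (the arithmetic factor): for the strip kernel `ψ(z) = Φ(Im z) e(η Re z)` with a
measurable profile `Φ` bounded by `B` and supported in `[Y₁, Y₂]` (`0 < Y₁ ≤ Y₂`), `η ≠ 0`, and a
level `q ≥ 1`,

  `∫_F |P_ψ|² dμ ≤ B² (Y₂ - Y₁)/Y₁² · (1 + 256 (Y₂/Y₁)^{1/2} (η,q)^{1/2} τ(ηq) q⁻¹ X^{1/2} (1 + log X))`,

`X = max(1, 1/Y₁)` (`setIntegral_norm_sq_poincareFn_stripKernel_le`), for every fundamental domain `F`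
of `Γ₀(q)`, granted that `P_ψ` is measurable and bounded (true for continuous profiles,
`…DFIPoincare`).  With `Y₁ ≍ 1/N`, `Y₂ = 2Y₁` this is DFI's
`R ≪ h Y⁻¹ Q`, `Q ≪ L² + L² (Y + Y⁻¹)^{1/2} h^{1/2} q⁻¹ (h,q)^{1/2} τ(hq)` ((20), (23) p. 430–431) for
the norm itself instead of the spectrally weighted sum `R`.  Everything here is proved; no statement of
the paper is vendored (no new named fact, no definition).

## References

* W. Duke, J. B. Friedlander, H. Iwaniec, Ann. of Math. (2) 141 (1995), 423–441, §3 (20)–(23).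
  [cite: DukeFriedlanderIwaniec1995, (20)–(23) p. 430–431]
* H. Iwaniec, *Spectral Methods of Automorphic Forms*, 2nd ed., GSM 53 (2002), §3.2, (2.25).
  [cite: Iwaniec2002, §3.2 and (2.25)]
-/

noncomputable section

namespace Literature.NumberTheory.Sieve

open scoped MatrixGroups UpperHalfPlane Real _root_.Topology _root_.ENNReal _root_.NNReal ComplexConjugate
open _root_.UpperHalfPlane _root_.MeasureTheory _root_.Set _root_.Filter
open _root_.ModularGroup (T)
open _root_.Literature.NumberTheory.Automorphic

namespace DFI1995

variable {q : ℕ}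

/-- A matrix of `SL₂(ℤ)` with bottom row `(c, d)` for coprime `c, d` (Bézout). [folklore] -/
theorem exists_sl_bottom_row (c d : ℕ) (h : Nat.Coprime c d) :
    ∃ γ : SL(2, ℤ), γ 1 0 = c ∧ γ 1 1 = d := by
  have hg : Int.gcd (c : ℤ) (d : ℤ) = 1 := by rw [Int.gcd_natCast_natCast]; exact h
  have hb : (c : ℤ) * Int.gcdA c d + (d : ℤ) * Int.gcdB c d = 1 := by
    have := Int.gcd_eq_gcd_ab (c : ℤ) (d : ℤ)
    rw [hg] at this
    exact_mod_cast this.symm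
  refine ⟨⟨!![Int.gcdB c d, -Int.gcdA c d; c, d], ?_⟩, rfl, rfl⟩
  rw [Matrix.det_fin_two_of]
  linarith

/-- **The `L²`-norm of the Poincaré series of a strip kernel (the bound).**  Let
`ψ(z) = Φ(Im z) e(η Re z)` with `Φ` measurable, `|Φ| ≤ B`, `Φ` supported in `[Y₁, Y₂]`
(`0 < Y₁ ≤ Y₂`), `η ≠ 0`, `q ≥ 1`; let `P = ∑_{σ ∈ Γ∞∖Γ₀(q)} ψ ∘ σ` be measurable and bounded and
`F` a fundamental domain of `Γ₀(q)`.  Then, with `X = max(1, 1/Y₁)`,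
`∫_F |P|² dμ ≤ B²(Y₂ - Y₁)/Y₁² · (1 + 256 (Y₂/Y₁)^{1/2} (η,q)^{1/2} τ(ηq) q⁻¹ X^{1/2}(1 + log X))`.
[cite: DukeFriedlanderIwaniec1995, (20)–(23) p. 430–431] -/
theorem setIntegral_norm_sq_poincareFn_stripKernel_le {q : ℕ} (hq : 0 < q) {Φ : ℝ → ℂ} {η : ℤ}
    (hη : η ≠ 0) (hΦm : Measurable Φ) {Y₁ Y₂ B CP : ℝ} (hY₁ : 0 < Y₁) (hY : Y₁ ≤ Y₂)
    (hsupp : ∀ y : ℝ, Φ y ≠ 0 → Y₁ ≤ y ∧ y ≤ Y₂) (hbd : ∀ y : ℝ, ‖Φ y‖ ≤ B)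
    (hPm : Measurable (RootForms.poincareFn q
      (fun z : ℍ => Φ z.im * Complex.exp (2 * π * Complex.I * η * (z.re : ℂ)))))
    (hP : ∀ z : ℍ, ‖RootForms.poincareFn q
      (fun z : ℍ => Φ z.im * Complex.exp (2 * π * Complex.I * η * (z.re : ℂ))) z‖ ≤ CP)
    {F : Set ℍ} (hF : IsHypFundamentalDomain (Gamma0GL q) F) :
    ∫ w in F, ‖RootForms.poincareFn q
        (fun z : ℍ => Φ z.im * Complex.exp (2 * π * Complex.I * η * (z.re : ℂ))) w‖ ^ 2 ≤
      B ^ 2 * ((Y₂ - Y₁) / Y₁ ^ 2) *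
        (1 + 256 * Real.sqrt (Y₂ / Y₁) * (Real.sqrt (Nat.gcd η.natAbs q) * ((η.natAbs * q).divisors.card : ℝ) / q *
          Real.sqrt (max 1 Y₁⁻¹) * (1 + Real.log (max 1 Y₁⁻¹)))) := by
  classical
  set ψ : ℍ → ℂ := fun z : ℍ => Φ z.im * Complex.exp (2 * π * Complex.I * η * (z.re : ℂ)) with hψ
  -- the kernel hypotheses in terms of `ψ`
  have hψm : Measurable ψ := by
    refine (hΦm.comp UpperHalfPlane.continuous_im.measurable).mul ?_
    exact (Complex.continuous_exp.comp (continuous_const.mul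
      (Complex.continuous_ofReal.comp UpperHalfPlane.continuous_re))).measurable
  have hψT : ∀ z : ℍ, ψ (T • z) = ψ z := fun z => stripKernel_T_smul Φ η z
  have hψsupp : ∀ z : ℍ, ψ z ≠ 0 → Y₁ ≤ z.im ∧ z.im ≤ Y₂ := fun z hz =>
    hsupp _ (left_ne_zero_of_mul hz)
  have hψbd : ∀ z : ℍ, ‖ψ z‖ ≤ B := fun z => by rw [hψ, norm_stripKernel]; exact hbd _
  -- the covering multiplicity and the matrices `γ_{c,d}`
  obtain ⟨M, hM⟩ := exists_multiplicity_box Y₂ hY₁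
  have hΓ : ∀ c d : ℕ, ∃ γ : SL(2, ℤ), Nat.Coprime c d → γ 1 0 = c ∧ γ 1 1 = d := by
    intro c d
    by_cases h : Nat.Coprime c d
    · obtain ⟨γ, h1, h2⟩ := exists_sl_bottom_row c d h
      exact ⟨γ, fun _ => ⟨h1, h2⟩⟩
    · exact ⟨1, fun h' => absurd h' h⟩
  choose Γm hΓm using hΓ
  have hΓm' : ∀ c d : ℕ, 0 < c → d < c → Nat.Coprime c d → (Γm c d) 1 0 = c ∧ (Γm c d) 1 1 = d :=
    fun c d _ _ hcop => hΓm c d hcop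
  -- unfolding
  obtain ⟨hmain, hXb⟩ := setIntegral_norm_sq_poincareFn_le hψm hψT hY₁ hψsupp hψbd hPm hP hM hF Γm hΓm'
  refine hmain.trans ?_
  -- the diagonal term
  have hdiag : ∫ w in strip, ‖ψ w‖ ^ 2 ≤ B ^ 2 * ((Y₂ - Y₁) / Y₁ ^ 2) :=
    setIntegral_strip_norm_sq_le hY₁ hY hψsupp hψbd
  -- the off-diagonal terms
  set ρ : ℝ := Real.sqrt (Y₂ / Y₁) with hρ
  set X : ℝ := max 1 Y₁⁻¹ with hX
  have hX1 : 1 ≤ X := le_max_left _ _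
  set N : ℕ := ⌊X⌋₊ with hN
  set Xc : ℕ → ℂ := fun c => if 0 < c ∧ q ∣ c then
    ∑ d ∈ (Finset.range c).filter (fun d => Nat.Coprime c d), ∫ w, conj (ψ (Γm c d • w)) * ψ w else 0 with hXc
  set wt : ℕ → ℝ := fun c => (c.divisors.card : ℝ) * Real.sqrt (Nat.gcd η.natAbs c) / Real.sqrt c with hwt
  set A : ℝ := B ^ 2 * ((2 * ρ) * (Y₂ - Y₁) / Y₁ ^ 2) with hA
  have hA0 : 0 ≤ A := by
    have : 0 ≤ ρ := Real.sqrt_nonneg _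
    apply mul_nonneg (sq_nonneg B)
    apply div_nonneg (mul_nonneg (by linarith) (by linarith)) (sq_nonneg _)
  -- termwise bound `‖X_c‖ ≤ 𝟙_{c ≤ N, q ∣ c} · A · wt c`
  have hterm : ∀ c : ℕ, ‖Xc c‖ ≤
      ((Finset.Icc 1 N).filter (fun c => q ∣ c) : Set ℕ).indicator (fun c => A * wt c) c := by
    intro c
    by_cases hc : 0 < c ∧ q ∣ c
    · obtain ⟨hc0, hqc⟩ := hc
      haveI : NeZero c := ⟨hc0.ne'⟩
      have hcR : (0 : ℝ) < c := by exact_mod_cast hc0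
      simp only [hXc]
      rw [if_pos ⟨hc0, hqc⟩]
      -- Kloosterman: `‖∑_d ∫ …‖ ≤ √(η,c) √c τ(c) ‖I_c‖`
      have h1 := norm_sum_integral_conj_stripKernel_smul_mul_le Φ η (c := c) (Γm c)
        (fun d hd hcop => hΓm' c d hc0 hd hcop)
      by_cases hcN : c ≤ N
      · have hmem : c ∈ ((Finset.Icc 1 N).filter (fun c => q ∣ c) : Set ℕ) := by
          simp only [Finset.coe_filter, Finset.mem_Icc, mem_setOf_eq]
          exact ⟨⟨hc0, hcN⟩, hqc⟩
        rw [indicator_of_mem hmem]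
        have h2 := norm_integral_offDiagKernel_le (Φ := Φ) η hcR hY₁ hY hsupp hbd
        refine h1.trans ?_
        have hI0 := norm_nonneg (∫ v : ℍ, conj (Φ (v.im / ((c : ℝ) ^ 2 * Complex.normSq (v : ℂ)))) * Φ v.im *
          Complex.exp (2 * π * Complex.I * η *
            ((v.re * (1 + 1 / ((c : ℝ) ^ 2 * Complex.normSq (v : ℂ))) : ℝ) : ℂ)))
        calc Real.sqrt (Nat.gcd η.natAbs c) * Real.sqrt c * (c.divisors.card : ℝ) *
              ‖∫ v : ℍ, conj (Φ (v.im / ((c : ℝ) ^ 2 * Complex.normSq (v : ℂ)))) * Φ v.im *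
                Complex.exp (2 * π * Complex.I * η *
                  ((v.re * (1 + 1 / ((c : ℝ) ^ 2 * Complex.normSq (v : ℂ))) : ℝ) : ℂ))‖
            ≤ Real.sqrt (Nat.gcd η.natAbs c) * Real.sqrt c * (c.divisors.card : ℝ) *
              (B ^ 2 * ((2 * ρ / c) * (Y₂ - Y₁) / Y₁ ^ 2)) :=
              mul_le_mul_of_nonneg_left h2 (by positivity)
          _ = A * wt c := by
              simp only [hA, hwt]
              set s : ℝ := Real.sqrt c with hs
              have hsc : s * s = c := Real.mul_self_sqrt hcR.le
              have hsc0 : s ≠ 0 := (Real.sqrt_pos.2 hcR).ne'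
              have hY0 : Y₁ ≠ 0 := hY₁.ne'
              rw [← hsc]
              field_simp
      · -- `c > N ≥ X ≥ 1/Y₁`: the kernel vanishes
        have hmem : c ∉ ((Finset.Icc 1 N).filter (fun c => q ∣ c) : Set ℕ) := by
          simp only [Finset.coe_filter, Finset.mem_Icc, mem_setOf_eq, not_and]
          intro h; exact absurd h.2 hcN
        rw [indicator_of_notMem hmem]
        have hcY : 1 < (c : ℝ) * Y₁ := by
          have hNX : X < (N : ℝ) + 1 := Nat.lt_floor_add_one X
          have hcN' : (N : ℝ) + 1 ≤ c := by exact_mod_cast Nat.lt_of_not_le hcN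
          have hXY : Y₁⁻¹ ≤ X := le_max_right _ _
          have hinv : Y₁⁻¹ < c := by linarith
          calc (1 : ℝ) = Y₁⁻¹ * Y₁ := (inv_mul_cancel₀ hY₁.ne').symm
            _ < c * Y₁ := mul_lt_mul_of_pos_right hinv hY₁
        have h0 := integral_offDiagKernel_eq_zero (Φ := Φ) η hcR hY₁ hcY hsupp
        rw [h0, norm_zero, mul_zero] at h1
        exact h1
    · simp only [hXc]
      rw [if_neg hc, norm_zero]
      exact indicator_nonneg (fun c _ => mul_nonneg hA0 (by positivity)) c
  -- summing
  have hXs : Summable fun c => ‖Xc c‖ := by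
    have hL : ∫⁻ w in strip, ‖ψ w‖ₑ < ⊤ := setLIntegral_strip_enorm_lt_top hY₁ hψsupp hψbd
    have hMBL : (M : ℝ≥0∞) * ENNReal.ofReal B * ∫⁻ w in strip, ‖ψ w‖ₑ ≠ ⊤ :=
      ENNReal.mul_ne_top (ENNReal.mul_ne_top (ENNReal.natCast_ne_top M) ENNReal.ofReal_ne_top) hL.ne
    have h' : Summable fun c => ‖Xc c‖₊ :=
      ENNReal.tsum_coe_ne_top_iff_summable.1 (ne_top_of_le_ne_top hMBL hXb)
    exact NNReal.summable_coe.2 h'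
  have hind_s : Summable (((Finset.Icc 1 N).filter (fun c => q ∣ c) : Set ℕ).indicator (fun c => A * wt c)) :=
    summable_of_hasFiniteSupport ((((Finset.Icc 1 N).filter (fun c => q ∣ c)).finite_toSet).subset
      (support_indicator_subset))
  have hsum : ∑' c, ‖Xc c‖ ≤ A * ∑ c ∈ (Finset.Icc 1 N).filter (fun c => q ∣ c), wt c := by
    calc ∑' c, ‖Xc c‖ ≤ ∑' c, ((Finset.Icc 1 N).filter (fun c => q ∣ c) : Set ℕ).indicator (fun c => A * wt c) c :=
          hXs.tsum_le_tsum hterm hind_s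
      _ = ∑ c ∈ (Finset.Icc 1 N).filter (fun c => q ∣ c),
            ((Finset.Icc 1 N).filter (fun c => q ∣ c) : Set ℕ).indicator (fun c => A * wt c) c :=
          tsum_eq_sum fun c hc => indicator_of_notMem (by exact_mod_cast hc) _
      _ = ∑ c ∈ (Finset.Icc 1 N).filter (fun c => q ∣ c), A * wt c :=
          Finset.sum_congr rfl fun c hc => indicator_of_mem (by exact_mod_cast hc) _
      _ = A * ∑ c ∈ (Finset.Icc 1 N).filter (fun c => q ∣ c), wt c := by rw [Finset.mul_sum]
  -- the divisor sum
  have hdiv := sum_tau_sqrt_gcd_div_sqrt_le (h := η.natAbs) (q := q) (Int.natAbs_ne_zero.2 hη) hq.ne' hX1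
  -- assemble
  have hwt_le : A * ∑ c ∈ (Finset.Icc 1 N).filter (fun c => q ∣ c), wt c ≤
      A * (128 * Real.sqrt (Nat.gcd η.natAbs q) * ((η.natAbs * q).divisors.card : ℝ) / q * Real.sqrt X *
        (1 + Real.log X)) := mul_le_mul_of_nonneg_left hdiv hA0
  calc (∫ w in strip, ‖ψ w‖ ^ 2) + ∑' c, ‖Xc c‖
      ≤ B ^ 2 * ((Y₂ - Y₁) / Y₁ ^ 2) + A * (128 * Real.sqrt (Nat.gcd η.natAbs q) *
          ((η.natAbs * q).divisors.card : ℝ) / q * Real.sqrt X * (1 + Real.log X)) :=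
        add_le_add hdiag (hsum.trans hwt_le)
    _ = B ^ 2 * ((Y₂ - Y₁) / Y₁ ^ 2) *
        (1 + 256 * ρ * (Real.sqrt (Nat.gcd η.natAbs q) * ((η.natAbs * q).divisors.card : ℝ) / q *
          Real.sqrt X * (1 + Real.log X))) := by
        simp only [hA]; ring

end DFI1995

end Literature.NumberTheory.Sieve
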